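import Summits.QuantumFields.YangMills.Theorems.BalabanUVNodesN17AtRateRecord13
import Summits.QuantumFields.YangMills.Theorems.BalabanUVNodesRateReadingOfRecord13

/-!
# BalabanUVNodes ∕ node N17 = NE4 AT dag-n22-e's NAMED STAGE-13 READING OF RECORD `YMDAG.UVSplit.readingOfRecord₁₃ w1 ℓ₃ ne2 ne1` (6″ `…RateReadingOfRecord13`), AT BOTH
# (T-RATE) ₁₃ HOMES: N17 reads W1's analytic-block letters `(w1 F θ).u3Objects θ.γ` at window radius `θ.γ` — ONE merged-β sentence per (guarded) tuple, `g₀ ∕ os ∕ ne1 ∕ ne2 ∕ ℓ₃` IDLE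

Cell `pub-ymgap`, HUMAN RULING D-0062, seat `pub-ymgap-dag-n17-c` (R134 fan-out, strategy s2 = BY-NAME KNIT AT THE RECORD), generation 9; companion 23 (§72) of `BalabanUVNodesN17Knit` …
`…N17AtRateRecord13` (companion 22).  THEOREMS ONLY (0 `def`); imports companion 22 (`s_N17_rRec₁₃On_iff_merged`, `s_N17_rRec₁₃_iff_merged`, `s_N17_rRec₁₃On_unityNondeg_iff_merged`)
and n22-e's 6″ `…RateReadingOfRecord13` (`readingOfRecord₁₃`, `readingOfRecord₁₃_u3 : ((readingOfRecord₁₃ w1 ℓ₃ ne2 ne1).lit F θ hP g₀ os).u3 = (w1 F θ).u3Objects θ.γ`, `rfl`);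
modifies nothing; every cited lemma used BY NAME.  Stage-13 twin of companion 19 §58 (p478440) — the face 6″'s header names for n17-c (`s_N17_readingOfRecord₁₃_iff`, layer B's
letters-level `iff`) with the run length eliminated and the β NAMED: `βmTχ(θ) := betaMerged F (mergedTermFamilyMatT F N (TcanOfRecord F N) (chiβOfRecord₁₃ F N θ) θ.εbg) θ.ρ8 θ.bV`.
(No `W1.assignment₁₃` container exists at ₁₃, so companion 19's `_w1Assignment_` face has no twin.)
* §72 `s_N17_rRec₁₃On_readingOfRecord₁₃_iff_merged` (regime-restricted home: for every admissible Stage-13 tuple with provisos in `Rg`, the `βmTχ(θ)` rate on `]0, θ.γ]` at the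
  dependent letters `(cr·C₅·θ₅, ρ)` of `(w1 F θ).u3Objects θ.γ`) · `s_N17_rRec₁₃On_readingOfRecord₁₃_unityNondeg_iff_merged` (at RR-2's guard of record `unityNondeg₁₃ N` = rev 16's
  bundle `θ.ZtUnity ∧ θ.SlotsNondegenerate₁₃`) · `s_N17_readingOfRecord₁₃_iff_merged` (canonical home: at every Stage-13 datum key, the `βmTχ(h.params)` rate at W1's letters at `h.params`).

HONEST FRAMING.  Kernel bookkeeping BY NAME; 0 sorry; NE4 NOT IN PRINT ([Balaban1987RG1] (1.20)–(1.22) p. 264) and NOT PROVED; W1's towers are residual DATA inside the named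
container (`w1` a parameter; inhabitation is not content); no inhabitant of any key claimed (K0‴ `Record13Inhabited`, stmt-QuantumFields-19909, open); N17 = composite (max of
N15, N16, (D4)), NOT discharged; counts UNMOVED (typed 28∕28 · discharged 5∕27, A 5∕28).  One finite four-torus at fixed ε per run — NOT ℝ⁴, NOT infinite volume, NOT OS, NOT a mass
gap, NOT Clay.
-/

noncomputable section

open scoped Matrix.Norms.L2Operator

namespace Summit.QuantumFields.YangMills.Theorems.BalabanUVNodesN17

open Literature.MathematicalPhysics.QuantumFieldTheory.Balaban1983to89
open Literature.MathematicalPhysics.QuantumFieldTheory.Balaban1983to89.FlowStep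
open Literature.MathematicalPhysics.QuantumFieldTheory.Balaban1983to89.T4CouplingMatching
open Literature.MathematicalPhysics.QuantumFieldTheory.Balaban1983to89.T4Continuum (T4Family FiniteEpsData ULoop)
open Literature.MathematicalPhysics.QuantumFieldTheory.Balaban1983to89.Node00
open YMDAG.UVSplit (Datum RateCarriers NE1pCarriers S_N17 RateReading₁₃ RRec₁₃ RRec₁₃On readingOfRecord₁₃)

variable {F : T4Family} {N : ℕ} [NeZero N]

/-! ## §72 N17 AT THE NAMED READING OF RECORD `readingOfRecord₁₃ w1 ℓ₃ ne2 ne1` (n22-e 6″), both homes -/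

section ReadingOfRecord

variable (w1 : (F : T4Family) → (θ : Stage13Params F N) → W1.ReadingData F (MatA N) θ.τ9.M) (ℓ₃ : T4Family → NE3Letters₁₁)
  (ne2 : (F : T4Family) → Stage13Params F N → (ℕ → ℝ) → List (ULoop F) → ℕ → NE2Objects₁₁)
  (ne1 : (F : T4Family) → Stage13Params F N → (ℕ → ℝ) → List (ULoop F) → NE1pCarriers)
  (Rg : (F : T4Family) → Stage13Params F N → Prop)

/-- **N17 AT THE READING OF RECORD, REGIME-RESTRICTED HOME**: `S_N17 (RRec₁₃On (readingOfRecord₁₃ w1 ℓ₃ ne2 ne1) Rg)` ⟺ for every family, every admissible Stage-13 tuple with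
provisos in the regime: the `βmTχ(θ)` rate on `]0, θ.γ]` at the dependent letters `(cr·C₅·θ₅, ρ)` of W1's U3 objects `(w1 F θ).u3Objects θ.γ` (`readingOfRecord₁₃_u3`, `rfl`) — ONE
sentence per guarded tuple; `g₀`, `os`, `ne1`, `ne2`, `ℓ₃` IDLE (companion 22 `s_N17_rRec₁₃On_iff_merged` at `(g₀, os) := (0, [])`). [cite: Balaban1987RG1, (1.20)-(1.22) p.264] -/
theorem s_N17_rRec₁₃On_readingOfRecord₁₃_iff_merged :
    S_N17 (RRec₁₃On (readingOfRecord₁₃ w1 ℓ₃ ne2 ne1) Rg) ↔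
      ∀ (F : T4Family) (θ : Stage13Params F N), θ.Provisos₁₃ F N → Rg F θ → θ.Admissible F N →
        letI := θ.instVβ₁; letI := θ.instVβ₂; letI := θ.instιβ
        ScaleShiftRate (((w1 F θ).u3Objects θ.γ).cr * ((w1 F θ).u3Objects θ.γ).C₅ * ((w1 F θ).u3Objects θ.γ).θ₅) ((w1 F θ).u3Objects θ.γ).ρ θ.γ
          (betaMerged F (mergedTermFamilyMatT F N (TcanOfRecord F N) (chiβOfRecord₁₃ F N θ) θ.εbg) θ.ρ8 θ.bV) := by
  rw [s_N17_rRec₁₃On_iff_merged]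
  exact ⟨fun H F θ hP hRg hθ => H F θ hP hRg hθ (fun _ => 0) [], fun H F θ hP hRg hθ _ _ => H F θ hP hRg hθ⟩

/-- **… AT node00-def-RR-2's GUARD OF RECORD `Node00.unityNondeg₁₃ N`** (rev 16's bundle `θ.ZtUnity F N ∧ θ.SlotsNondegenerate₁₃ F N`; the `h17` of a composer keyed at the reading of
record and the guard of record): the same sentence asked only of the guarded admissible tuples with provisos. [cite: Balaban1987RG1, (1.20)-(1.22) p.264; Balaban1988Convergent, (3.16)-(3.22) pp.268-269] -/
theorem s_N17_rRec₁₃On_readingOfRecord₁₃_unityNondeg_iff_merged :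
    S_N17 (RRec₁₃On (readingOfRecord₁₃ w1 ℓ₃ ne2 ne1) (unityNondeg₁₃ N)) ↔
      ∀ (F : T4Family) (θ : Stage13Params F N), θ.Provisos₁₃ F N → θ.ZtUnity F N ∧ θ.SlotsNondegenerate₁₃ F N → θ.Admissible F N →
        letI := θ.instVβ₁; letI := θ.instVβ₂; letI := θ.instιβ
        ScaleShiftRate (((w1 F θ).u3Objects θ.γ).cr * ((w1 F θ).u3Objects θ.γ).C₅ * ((w1 F θ).u3Objects θ.γ).θ₅) ((w1 F θ).u3Objects θ.γ).ρ θ.γ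
          (betaMerged F (mergedTermFamilyMatT F N (TcanOfRecord F N) (chiβOfRecord₁₃ F N θ) θ.εbg) θ.ρ8 θ.bV) :=
  s_N17_rRec₁₃On_readingOfRecord₁₃_iff_merged w1 ℓ₃ ne2 ne1 _

/-- **… AND AT THE CANONICAL HOME OF THE READING OF RECORD** (companion 22 `s_N17_rRec₁₃_iff_merged` with the run inputs dropped; n22-e's `s_N17_readingOfRecord₁₃_iff` with the run
length eliminated and the β named): `S_N17 (RRec₁₃ (readingOfRecord₁₃ …))` ⟺ at every Stage-13 datum key, the `βmTχ(h.params)` rate at W1's letters at `h.params`.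
[cite: Balaban1987RG1, (1.20)-(1.22) p.264] -/
theorem s_N17_readingOfRecord₁₃_iff_merged :
    S_N17 (RRec₁₃ (readingOfRecord₁₃ w1 ℓ₃ ne2 ne1)) ↔
      ∀ (F : T4Family) (D : Datum F N) (h : IsDatumOfRecord₁₃C F N D),
        letI := h.params.instVβ₁; letI := h.params.instVβ₂; letI := h.params.instιβ
        ScaleShiftRate
          (((w1 F h.params).u3Objects h.params.γ).cr * ((w1 F h.params).u3Objects h.params.γ).C₅ * ((w1 F h.params).u3Objects h.params.γ).θ₅)
          ((w1 F h.params).u3Objects h.params.γ).ρ h.params.γ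
          (betaMerged F (mergedTermFamilyMatT F N (TcanOfRecord F N) (chiβOfRecord₁₃ F N h.params) h.params.εbg) h.params.ρ8 h.params.bV) := by
  rw [s_N17_rRec₁₃_iff_merged]
  exact ⟨fun H F D h => H F D h (fun _ => 0) [], fun H F D h _ _ => H F D h⟩

end ReadingOfRecord

end Summit.QuantumFields.YangMills.Theorems.BalabanUVNodesN17

end
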